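import Mathlib
import Summits.RiemannHypothesis.RiemannHypothesis.Theorems.ScrewManifestCertDefs
import Summits.RiemannHypothesis.RiemannHypothesis.Theorems.ZetaScrewCuspExpansion

/-!
# RH-FREE SKETCH (sos-theory g19, note 2 — HOME/sos/theory/SCREW-P3-FOLD-NOTE-g19.md §2):
the three lemmas to which `CornerCostLaw` (S1 of `Theorems/ScrewManifestCornerLaw.lean`, p457280)
reduces.  TYPED TARGETS ONLY (Prop slots, nothing proved here); a prover hand closes
`CuspBound → CornerGap → LagDensity → CornerCostLaw` (≈ 150 lines of bookkeeping, note §2 ASSEMBLY)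
and then `PlateauBound → SuperlinearFloor` via the tree's `superlinearFloor_of_cornerCostLaw`.

* `CuspBound`  (L1, literature-grade, RH-free closed form of the screw function below `log 2`):
  `|Ψ(u) − (u/2)·log(1/u)| ≤ C₀·u` on `(0, u₀]`.
* `CornerGap`  (L2, THE HEART, pure analysis): no nonnegative cosine-atom sum with frequencies `≤ θ`
  is `ε`-close to `s/2` on a `δ`-dense subset of `[1, 3]` (Helly + the limit is an entire EVEN function).
* `LagDensity` (L3, elementary): the scaled near lags `(n+1)·(log(i+2) − log(j+2))` of the rows in the
  top half are `δ`-dense in `[1, 3]` for large `n`.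
Nothing here bears on the truth of RH.
-/

set_option linter.dupNamespace false
set_option autoImplicit false

namespace Summit.RiemannHypothesis.RiemannHypothesis.Theorems.IntegerScrew.Manifest

open Literature.NumberTheory.LFunctions Finset

/-- RH-FREE slot L1 (CUSP BOUND): the screw function has the cusp `(u/2)·log(1/u) + O(u)` at `0⁺`
(ADD-B B1: `Ψ(v) = (v/2)log(1/(2πv)) + (1−γ)v/2 + o(v)`; only the `O(u)` form is needed). -/
def CuspBound : Prop :=
  ∃ C₀ u₀ : ℝ, 0 < u₀ ∧ ∀ u : ℝ, 0 < u → u ≤ u₀ →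
    |zetaScrew u - u / 2 * Real.log (1 / u)| ≤ C₀ * u

/-- RH-FREE slot L2 (CORNER GAP): for every band limit `θ` there are `ε, δ > 0` such that no
nonnegative combination of atoms `(1 − cos τs)/τ²`, `0 < τ ≤ θ`, is within `ε` of `s/2` at every
point of a `δ`-dense finite subset of `[1, 3]`.  (Proof route: mass control on `[1,2]`,
equicontinuity, Helly; a limit measure would give an ENTIRE EVEN function equal to `s/2` on `[1,3]`.) -/
def CornerGap : Prop :=
  ∀ θ : ℝ, 0 < θ → ∃ ε δ : ℝ, 0 < ε ∧ 0 < δ ∧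
    ∀ (K : ℕ) (τ W : Fin K → ℝ) (P : Finset ℝ),
      (∀ k, 0 < τ k ∧ τ k ≤ θ ∧ 0 ≤ W k) →
      (∀ p ∈ P, 1 ≤ p ∧ p ≤ 3) →
      (∀ x : ℝ, 1 ≤ x → x ≤ 3 → ∃ p ∈ P, |x - p| ≤ δ) →
        ∃ s ∈ P, ε ≤ |(∑ k, W k * (1 - Real.cos (τ k * s)) / (τ k) ^ 2) - s / 2|

/-- RH-FREE slot L3 (LAG DENSITY): for large `n` the scaled near lags
`(n+1)·(node i − node j)`, rows `i > j` in the top half with `i − j ≤ 6`, are `δ`-dense in `[1, 3]`. -/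
def LagDensity : Prop :=
  ∀ δ : ℝ, 0 < δ → ∃ M₀ : ℕ, ∀ n : ℕ, M₀ ≤ n + 1 →
    ∀ x : ℝ, 1 ≤ x → x ≤ 3 →
      ∃ i j : Fin n, ((n : ℝ) + 1 ≤ 2 * ((j : ℕ) + 2)) ∧ (j : ℕ) < (i : ℕ) ∧ (i : ℕ) ≤ (j : ℕ) + 6 ∧
        |x - ((n : ℝ) + 1) * (node n i - node n j)| ≤ δ


/-- L1 HOLDS (RH-FREE): immediate from the tree's cusp expansion
`IntegerScrew.abs_zetaScrew_sub_cusp_le` (p458518, `|Ψ(t) − ((t/2)log(1/t) + c·t)| ≤ 6t²` on `(0, 1/2]`,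
`c = (1 − γ₀ − log 2π)/2`): take `u₀ = 1/2`, `C₀ = |c| + 3`. -/
theorem cuspBound_holds : CuspBound := by
  refine ⟨|(1 - Real.eulerMascheroniConstant - Real.log (2 * Real.pi)) / 2| + 3, 1 / 2,
    by norm_num, ?_⟩
  intro u hu hu2
  have h := abs_zetaScrew_sub_cusp_le hu hu2
  set c := (1 - Real.eulerMascheroniConstant - Real.log (2 * Real.pi)) / 2 with hc
  have h1 : |zetaScrew u - u / 2 * Real.log (1 / u)|
      ≤ |zetaScrew u - (u / 2 * Real.log (1 / u) + c * u)| + |c * u| := by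
    have e : zetaScrew u - u / 2 * Real.log (1 / u)
        = (zetaScrew u - (u / 2 * Real.log (1 / u) + c * u)) + c * u := by ring
    rw [e]; exact abs_add_le _ _
  have h2 : |c * u| = |c| * u := by rw [abs_mul, abs_of_pos hu]
  have h3 : 0 ≤ u * (1 / 2 - u) := mul_nonneg hu.le (by linarith)
  have h4 : 0 ≤ |c| := abs_nonneg c
  calc |zetaScrew u - u / 2 * Real.log (1 / u)| ≤ 6 * u ^ 2 + |c| * u := by linarith
    _ ≤ (|c| + 3) * u := by nlinarith

end Summit.RiemannHypothesis.RiemannHypothesis.Theorems.IntegerScrew.Manifest
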